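import Summits.BirchSwinnertonDyer.BirchSwinnertonDyer.Theorems.InertBadSignedBranchesInertBadAtThreeQuarticStub
import Summits.BirchSwinnertonDyer.BirchSwinnertonDyer.Theorems.InertBadSignedBranchesInertBadAtThreeQuarticOfDictionary
import Summits.BirchSwinnertonDyer.BirchSwinnertonDyer.Theorems.InertBadSignedBranchesInertBadAtThreeManinCells
import Summits.BirchSwinnertonDyer.BirchSwinnertonDyer.Theorems.InertBadSignedBranchesInertBadAtThreeOddPrimeInstances
import HarnessLib

/-!
# The quartic cell at `p = 3`, UNCONDITIONALLY: F-es-18's body on `j = 1728` bad at `3` (both parities) and Manin's `3 ∤ c` on the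
# CM Kodaira III/III* cell

Summit `BirchSwinnertonDyer`, crux `InertBadAtThree` (stmt-BirchSwinnertonDyer-19225; K8 `InertBadSignedBranches` r4 / BED
`BiquadraticEisensteinDescent` r5), line of record `Cruxes/InertBadAtThree/Lines/rubin_e1_inert_three.lean` v6 (lead `bsd-line-ibd-p1` g7;
`--supports 19225`, helper). The line's quartic stub is closed (`…QuarticStub.stub_plainOddNeronIntegralThreeQuartic`, p632832); this file
records the three corollaries the tree can now state WITHOUT any hypothesis (resp. modulo print only):

* ★ `neronIntegralThreeQuartic` — C⁺_quartic = the v4 statement `NeronIntegralThreeQuartic` of the Lines file: the body of the named Literature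
  statement F-es-18 `kato_neron_isIntegral_twistedSymbolSum_of_additive_three_polar` (Kato, Astérisque 295, (8.1.3)/Thm 9.7/Thm 6.6 (1), read in Néron
  units at the additive `3`) for EVERY globally minimal `V/ℚ` with `j(V) = 1728` bad at `3` — both parities, every level, every modulus prime to `3N`,
  every primitive `χ` — PROVED on the CM side (`neronIntegralThreeQuartic_of_dictionary` ∘ `model_thetaDictionary`). Consumers: crux 22968's
  `kato_shift_three` debt restricted to the quartic cell; the Lines file's `maninAtThreeQuartic_of_pointwiseLever_of_quarticFact`.
* ★ `maninAtThreeQuartic` — the Lines file's `ManinAtThreeQuartic` (text of the `hRes` binder of `…ManinCells.maninAtThree_of_facts_of_quarticResidual`):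
  for a CM curve `W` of analytic rank one with CM-inert bad `3`, `j(W) = 1728` and Kodaira type III or III* at `3`, and a lattice-optimal
  conductor-level `X₀(N_W)`-parametrisation datum `D`: **`3 ∤ c(D)`** — UNCONDITIONAL (`…OddPrimeInstances.not_three_dvd_c_of_plainOddInstances_of_hasCM`
  ∘ the landed stub). This is the residual Manin cell of K8's held child `InertBadAtThreeOffIstarZero` (stmt-19657) at `p = 3`.
* `maninAtThree_of_print` — the Lines file's R₃ `ManinAtThree` (whole CM-inert bad-`3` class) modulo the four PRINTED inputs only (Mazur 1978 Cor. 4.1,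
  Abbes–Ullmo 1996 Thm A, Česnavičius 2018 Thm 1.2, modularity `exists_isNewformOf`), via `…ManinCells.maninAtThree_of_facts_of_quarticResidual`.

HONEST FRAMING: the crux `InertBadAtThree` is NOT closed (its heart `stub_heartAtThree` is research, W-19); BSD is not proved by any of this. No
definitions, no named facts, no `sorry`; axioms standard.
-/

set_option linter.dupNamespace false
set_option autoImplicit false

noncomputable section

open scoped ComplexConjugate
open Complex IsDedekindDomain
open Literature.NumberTheory.EllipticCurves Literature.NumberTheory.EllipticCurves.ModularForms
  Literature.NumberTheory.EllipticCurves.Rank1Residual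
open Literature.NumberTheory.LFunctions Literature.NumberTheory.LFunctions.GaussianTheta
open Literature.NumberTheory.QuadraticFields.GaussianQuarticSymbol

namespace Summit.BirchSwinnertonDyer.BirchSwinnertonDyer.Theorems.InertBadSignedBranchesInertBadAtThreeQuarticCell

open Summit.BirchSwinnertonDyer.Rank1Residual
open Summit.BirchSwinnertonDyer.BirchSwinnertonDyer.Theorems.InertBadSignedBranchesInertBadAtThreeQuarticTheta (toComplex_quarticCharThree)
open Summit.BirchSwinnertonDyer.BirchSwinnertonDyer.Theorems.InertBadSignedBranchesInertBadAtThreeQuarticStub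
  (model_thetaDictionary stub_plainOddNeronIntegralThreeQuartic)
open Summit.BirchSwinnertonDyer.BirchSwinnertonDyer.Theorems.InertBadSignedBranchesInertBadAtThreeQuarticCleanAssembly
  (neronIntegralThreeQuartic_of_dictionary)

/-- ★ **C⁺_quartic, UNCONDITIONAL: F-es-18's body on the quartic cell.** For every globally minimal `V/ℚ` with `j(V) = 1728` bad at `3`, every
newform `f` of `V` of any level `N`, every modulus `m` coprime to `3N`, every primitive `χ` mod `m` with `χ ≠ 1`, `3 ∤ ord χ`, `χ(3) ∉ {1, −1}`,
and `ϖ, r` as in F-es-18: the even resp. odd symmetrised Birch–Manin value is `3`-integral in Néron units (`∃ s, 3 ∤ s, s·ϖ·r ∈ ℤ̄`). Proved on the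
CM side: Ireland–Rosen 18.7 theta dictionary for `y² = x³ + Ax` (`model_thetaDictionary`), finite Eisenstein–Kronecker formula, CRT into `χ₄^k`-twisted
`3`-torsion sums of `E₁*`, closed forms, torsion integrality, model periods (`neronIntegralThreeQuartic_of_dictionary`).
[cite: Kato2004Asterisque, (8.1.3) (p. 180), Thm. 9.7 (p. 189), Thm. 6.6 (1) (p. 163)] [cite: IrelandRosen1990, Ch. 18 §6, Theorem 7] [cite: Rubin1999, Prop. 7.15] -/
theorem neronIntegralThreeQuartic :
    ∀ (V : WeierstrassCurve ℚ) [V.IsElliptic] [V.IsGloballyMinimal],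
      V.j = 1728 → ¬ V.HasGoodReductionAtPrime 3 →
      ∀ {N : ℕ} [NeZero N]
        (f : CuspForm (CongruenceSubgroup.Gamma0 N) 2)
        (_ : Literature.NumberTheory.EllipticCurves.ModularForms.IsNewformOf V f)
        (_ : ¬ V.HasGoodReductionAtPrime 3) (_ : ¬ V.HasMultiplicativeReductionAtPrime 3)
        (_ : V.HasIrreducibleModPGaloisRep 3) (m : ℕ) [NeZero m] (_ : m.Coprime (3 * N))
        (χ : DirichletCharacter ℂ m) (_ : χ.IsPrimitive) (_ : χ ≠ 1) (_ : ¬ 3 ∣ orderOf χ)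
        (_ : χ (3 : ZMod m) ≠ 1) (_ : χ (3 : ZMod m) ≠ -1) (ϖ : ℚ) (r : ℂ),
        (χ.Even → (ϖ : ℝ) * V.realPeriodRat = Literature.NumberTheory.EllipticCurves.ModularForms.plusPeriod f →
          (∏ ℓ ∈ N.primeFactors with ¬ ℓ ^ 2 ∣ N,
              (((ℓ : ℂ) - (V.LFunction ℓ : ℂ) * χ (ℓ : ZMod m)) *
                ((ℓ : ℂ) - (V.LFunction ℓ : ℂ) * (χ (ℓ : ZMod m))⁻¹))) *
              Literature.NumberTheory.EllipticCurves.ModularForms.twistedSymbolSum f χ =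
            r * (Literature.NumberTheory.EllipticCurves.ModularForms.plusPeriod f : ℂ) →
          ∃ s : ℕ, ¬ 3 ∣ s ∧ IsIntegral ℤ ((s : ℂ) * ϖ * r)) ∧
        (χ.Odd → (ϖ : ℝ) * V.imaginaryPeriodRat = Literature.NumberTheory.EllipticCurves.ModularForms.minusPeriod f →
          (∏ ℓ ∈ N.primeFactors with ¬ ℓ ^ 2 ∣ N,
              (((ℓ : ℂ) - (V.LFunction ℓ : ℂ) * χ (ℓ : ZMod m)) *
                ((ℓ : ℂ) - (V.LFunction ℓ : ℂ) * (χ (ℓ : ZMod m))⁻¹))) *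
              Literature.NumberTheory.EllipticCurves.ModularForms.twistedSymbolSum f χ =
            r * (Literature.NumberTheory.EllipticCurves.ModularForms.minusPeriod f : ℂ) * Complex.I →
          ∃ s : ℕ, ¬ 3 ∣ s ∧ IsIntegral ℤ ((s : ℂ) * ϖ * r)) :=
  neronIntegralThreeQuartic_of_dictionary (q := fun x ↦ ((quarticCharThree x : GaussianInt) : ℂ)) toComplex_quarticCharThree
    (fun A hA h3A h4 m _ h3m χ _ ↦ model_thetaDictionary A hA h3A h4 m h3m χ)

/-- ★ **Manin's `3 ∤ c` on the CM quartic III/III* cell at `3`, UNCONDITIONAL** (the Lines file's `ManinAtThreeQuartic`, = the `hRes` binder of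
`…ManinCells.maninAtThree_of_facts_of_quarticResidual`): for an elliptic, globally minimal `W/ℚ` with CM, analytic rank `1`, CM-inert bad `p = 3`,
`j(W) = 1728` and Kodaira type `III` or `III*` at the place over `3`, every conductor-level modular parametrisation datum `D` whose lattice is
`c`-optimal has `3 ∤ c(D)`. Proof: the datum-level pointwise Kato shift lever for CM curves (`not_three_dvd_c_of_plainOddInstances_of_hasCM`, lead g6)
fed with the plain odd Néron `3`-integrality on the quartic cell (`stub_plainOddNeronIntegralThreeQuartic`, now a theorem).
[cite: Mazur1978, §6 Prop. 6.3 (1) (p. 153)] [cite: Kato2004Asterisque, Thm. 9.7 (p. 189)] -/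
theorem maninAtThreeQuartic :
    ∀ (W : WeierstrassCurve ℚ) [W.IsElliptic] [W.IsGloballyMinimal] [NeZero (W.conductorNorm ℤ)] (p : ℕ) [Fact p.Prime]
      (D : Literature.NumberTheory.EllipticCurves.ModularForms.ModularParametrizationData W (W.conductorNorm ℤ))
      (v : IsDedekindDomain.HeightOneSpectrum ℤ), Rat.HeightOneSpectrum.natGenerator v = p → W.HasCM → W.analyticRank = 1 → p = 3 →
      Literature.NumberTheory.EllipticCurves.Rank1Residual.CMInert W p → ¬ Literature.NumberTheory.EllipticCurves.Rank1Residual.Good W p →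
      (∀ z ∈ D.L.lattice, ∃ w ∈ Literature.NumberTheory.EllipticCurves.ModularForms.periodLattice D.f, z = D.c * w) →
      (W.j = 1728 ∧ (W.kodairaSymbolAt v = Literature.NumberTheory.DiophantineGeometry.KodairaSymbol.III ∨
        W.kodairaSymbolAt v = Literature.NumberTheory.DiophantineGeometry.KodairaSymbol.IIIstar)) → ¬ (p : ℤ) ∣ D.c := by
  intro W _ _ _ p _ D v _ hCM _ h3 hin hbad hopt hq
  subst h3
  exact InertBadSignedBranchesInertBadAtThreeOddPrimeInstances.not_three_dvd_c_of_plainOddInstances_of_hasCM W D hopt hCM hin hbad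
    (fun ℓ _ hℓ hℓN h12 χ hχ hχ3 ϖ r hϖ hval ↦
      stub_plainOddNeronIntegralThreeQuartic W hq.1 hbad D.f D.isNewformOf ℓ hℓ hℓN h12 χ hχ hχ3 ϖ r hϖ hval)

/-- **R₃ `ManinAtThree` modulo PRINT only** (the Lines file's `ManinAtThree`: `3 ∤ c` for every lattice-optimal conductor-level datum of a CM curve of
analytic rank one with CM-inert bad `3`): the `Iₙ*` cells by the three printed Manin facts + modularity (`…ManinCells.maninAtThree_of_facts_of_quarticResidual`,
bed-w2 g7), the III/III* cell by `maninAtThreeQuartic`. [cite: Mazur1978, Cor. 4.1] [cite: AbbesUllmo1996, Thm. A] [cite: Cesnavicius2018, Thm. 1.2] -/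
theorem maninAtThree_of_print
    (hM : mazur_not_dvd_maninConstant_of_odd)
    (hAU : abbesUllmo_not_dvd_maninConstant_of_not_dvd_level)
    (hC2 : cesnavicius_not_two_dvd_maninConstant_of_two_dvd_level)
    (hnf : exists_isNewformOf) :
    ∀ (W : WeierstrassCurve ℚ) [W.IsElliptic] [W.IsGloballyMinimal] [NeZero (W.conductorNorm ℤ)]
      (p : ℕ) [Fact p.Prime]
      (D : Literature.NumberTheory.EllipticCurves.ModularForms.ModularParametrizationData W (W.conductorNorm ℤ)),
      W.HasCM → W.analyticRank = 1 → p = 3 →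
      Literature.NumberTheory.EllipticCurves.Rank1Residual.CMInert W p →
      ¬ Literature.NumberTheory.EllipticCurves.Rank1Residual.Good W p →
      (∀ z ∈ D.L.lattice, ∃ w ∈ Literature.NumberTheory.EllipticCurves.ModularForms.periodLattice D.f,
        z = D.c * w) → ¬ (p : ℤ) ∣ D.c :=
  InertBadSignedBranchesInertBadAtThreeManinCells.maninAtThree_of_facts_of_quarticResidual hM hAU hC2 hnf maninAtThreeQuartic

end Summit.BirchSwinnertonDyer.BirchSwinnertonDyer.Theorems.InertBadSignedBranchesInertBadAtThreeQuarticCell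

end
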